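import Summits.BirchSwinnertonDyer.Rank1Residual.X9.PrintCertHeegner
import Literature.NumberTheory.QuadraticFields.ImaginaryQuadraticClassNumberValues
import HarnessLib

/-!
# Leaves X9 / X10b — per-pair certificate records: HOWARD FRAMES — route-compatible Heegner frames with `d_K` odd and
# `p ∤ h_K` DECIDED IN THE KERNEL (records v4, tool file)

HONEST FRAMING (cell `bsd-print-x9`, D-0131 (2) print tier; partition leaves `ClassX9` and `ClassX10 ∧ ¬Surj`):
theorems and plumbing definitions only; no named fact; no new data structure (the certificates are the `HeegnerCert`s of
records v3, `X9/PrintCertHeegner.lean`); nothing is asserted about any elliptic curve beyond what the kernel rechecks; no leaf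
is claimed closed (`BSDpOnClassX9`, `BSDpOnClassX10b` stay `@[conjecture]`; cruxes J = item 20392, J₃ = item 21340 stay OPEN).

WHY. The J-free «Howard road» of the cell (prover p4 gen 3, road (A): Mastella–Zerman 2026 Cor. 4.6 = Howard's Theorem B
without surjectivity, typed as `MastellaZerman2026.cor46_howardDivisibility_of_scalarImage`, composed with the Yan–Zhu 2026 /
BCS / CGLS composite `YanZhu2026.thm57_thm59_bcs422_cgls513_generator_constantCoeff_of_heegnerDivisibility`) runs on a
HEEGNER FRAME `K` of the pair `(E, p)` carrying, besides the frame binders of records v3 (every `q ∣ N` split, `p` split,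
`|d_K| > 4`, `4N ∣ β² − d_K`, `d_K ≡ 1 (mod 8)` at `p = 3`), the binders `Odd d_K`, `d_K ≠ -3, -4` and — the only one that is
not frame arithmetic — **`p ∤ h_K`** (MZ26 Assumption 2.1; the field `not_dvd_classNumber` of `MastellaZerman2026.Hypotheses`,
the hypothesis `hh` of the leaf-side constructor `ClassX9.mz26Hypotheses`, and the `¬ p ∣ NumberField.classNumber K` binder
of the YZ26 composite). Per pair this binder is a CERTIFICATE, and the tree decides it IN THE KERNEL: the form class number
`Quadratic.BinQF.classNumber D` (number of reduced primitive positive definite forms of discriminant `D`, Cox Thm. 2.13) is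
computable (`decide +kernel`, cost `O(|D|)`), and `ClassNumberValues.not_dvd_classNumber_of_discr_eq` (Cox Thm. 7.7(ii):
`h(d_K) = h_K`, the tree's `Quadratic.card_reducedForms_eq_classNumber`) turns `p ∤ h(D)` into `¬ p ∣ NumberField.classNumber K`
for ANY quadratic number field `K` with `d_K = D`. So the v3 certificate field `HeegnerCert.classNumber` — documentation in
records v3 — becomes a KERNEL FACT here.

* `Record.passHClassNumber r c` (decidable): `D` odd, `Quadratic.BinQF.classNumber c.D = c.classNumber` (the kernel recomputes
  `h(D)`), `p ∤ c.classNumber`.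
* `Record.howardCheck r c := r.heegnerCheck c ∧ r.passHClassNumber c` — a HOWARD FRAME CERTIFICATE is a records-v3 Heegner frame
  certificate (all of its checks, incl. the J-screen `ord_p ∏c ≤ v_p(m_K)` and its GZ–BSD coherence) whose frame is odd with
  `p ∤ h(d_K)`.
* SOUNDNESS, for ANY number field `K` with `[K:ℚ] = 2` and `NumberField.discr K = c.D`: `Record.classNumber_eq_of_howardCheck :
  NumberField.classNumber K = c.classNumber`, `Record.not_dvd_classNumber_of_howardCheck : ¬ p ∣ NumberField.classNumber K`,
  `Record.odd_discr_of_howardCheck : Odd (NumberField.discr K)`, `Record.discr_ne_of_howardCheck : d_K ≠ -3 ∧ d_K ≠ -4`,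
  `Record.not_dvd_discr_of_howardCheck : ¬ (p : ℤ) ∣ d_K`; and, for ANY globally minimal `W` with the record's integral model,
  the package `Record.howardFrame_of_howardCheck` = the records-v3 frame (`Record.frame_of_heegnerCheck`) ∧ `Odd d_K` ∧
  `d_K ≠ -3, -4` ∧ `¬ p ∣ h_K` — i.e. every `K`-side hypothesis of `ClassX9.mz26Hypotheses` (`hK` is the consumer's own
  quantifier, `hHeeg`, `hHp`, `hne`, `hh`) and of the YZ26 composite (`hHN`, `hHp`, `hodd`, `h3`, `hhK`).
* `howardScreen rs sel cs` (one Boolean per slice, `decide +kernel` in `X9/PrintCertHowardCertified*.lean`) and its unpacking.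
NOT checked (CLAIMS, as in records v3): that `m_K` is the Heegner index of the frame, `#Ш_an(E^D)`, `L(E^D,1) ≠ 0`, `#E(K)_tors`,
`N(W) = r.conductor`. The class number is NOT a claim any more.

References: D. A. Cox, *Primes of the form x² + ny²*, 2nd ed. (2013), §2.A Thm. 2.13, §7.B Thm. 7.7(ii) [Cox2013];
D. Mastella, F. Zerman, arXiv:2505.08710 (2026), Assumption 2.1, Cor. 4.6 [MastellaZerman2026]; B. Howard, Compos. Math. 140
(2004), Thm. B [Howard2004HeegnerKolyvagin]; B. H. Gross, D. Zagier, Invent. Math. 84 (1986) I §3, V (2.2) [GrossZagier1986];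
D. A. Marcus, *Number Fields*, Ch. 3 Thm. 25 [Marcus1977].
-/

set_option autoImplicit false

open scoped NumberField
open WeierstrassCurve
open Summit.BirchSwinnertonDyer.Rank1Residual.Additive
open Literature.NumberTheory.EllipticCurves (IsImaginaryQuadratic SatisfiesHeegnerHypothesis)
open Literature.NumberTheory.QuadraticFields (Quadratic.BinQF.classNumber)
open Literature.NumberTheory.QuadraticFields.ClassNumberValues (classNumber_eq_of_discr_eq not_dvd_classNumber_of_discr_eq)

namespace Summit.BirchSwinnertonDyer.Rank1Residual.X9.PrintCert

namespace Record

variable (r : Record)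

/-- The CLASS-NUMBER PART of a Howard frame certificate: `D` odd; the certificate's `classNumber` field IS `h(D)`, recomputed
by the kernel as the number of reduced primitive positive definite forms of discriminant `D` (`Quadratic.BinQF.classNumber`);
and `p ∤ h(D)`. [cite: Cox2013, §2.A Thm. 2.13] [cite: MastellaZerman2026, Assumption 2.1] -/
def passHClassNumber (c : HeegnerCert) : Bool :=
  decide (c.D % 2 ≠ 0) && decide (Quadratic.BinQF.classNumber c.D = c.classNumber) && decide (¬ r.p ∣ c.classNumber)

/-- The KERNEL CHECK of a HOWARD FRAME CERTIFICATE against a record: the records-v3 Heegner frame check (keys, discriminant part,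
splitting witnesses, the J-screen with its GZ–BSD coherence, the twist's BSD coherence — `Record.heegnerCheck`) AND the
class-number part (`D` odd, `h(D)` recomputed, `p ∤ h(D)`). [cite: MastellaZerman2026, Assumption 2.1, Cor. 4.6]
[cite: Cox2013, §2.A Thm. 2.13] -/
def howardCheck (c : HeegnerCert) : Bool :=
  r.heegnerCheck c && r.passHClassNumber c

variable {r}

/-- A passing Howard check contains a passing records-v3 Heegner frame check. [folklore] -/
theorem heegnerCheck_of_howardCheck {c : HeegnerCert} (h : r.howardCheck c = true) : r.heegnerCheck c = true := by
  simp only [howardCheck, Bool.and_eq_true] at h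
  exact h.1

/-- Unpacking the class-number part: `D` odd, `h(D) = c.classNumber` (kernel value), `p ∤ h(D)`. [cite: Cox2013, §2.A Thm. 2.13] -/
theorem classNumber_of_howardCheck {c : HeegnerCert} (h : r.howardCheck c = true) :
    c.D % 2 ≠ 0 ∧ Quadratic.BinQF.classNumber c.D = c.classNumber ∧ ¬ r.p ∣ c.classNumber := by
  simp only [howardCheck, passHClassNumber, Bool.and_eq_true, decide_eq_true_eq] at h
  exact ⟨h.2.1.1, h.2.1.2, h.2.2⟩

section Frame

variable {K : Type} [Field K] [NumberField K]

/-- **SOUNDNESS (`h_K` is the certificate's class number).** For any quadratic number field `K` with `d_K = D`: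
`NumberField.classNumber K = c.classNumber` — Cox Thm. 2.13 (`h(D)` = number of reduced forms, the kernel's count) with
Thm. 7.7(ii) (`h(d_K) = h_K`, the tree's `Quadratic.card_reducedForms_eq_classNumber` through
`ClassNumberValues.classNumber_eq_of_discr_eq`). [cite: Cox2013, §2.A Thm. 2.13; §7.B Thm. 7.7(ii)] -/
theorem classNumber_eq_of_howardCheck {c : HeegnerCert} (hh : r.howardCheck c = true) (hK2 : Module.finrank ℚ K = 2)
    (hd : NumberField.discr K = c.D) : NumberField.classNumber K = c.classNumber :=
  classNumber_eq_of_discr_eq hK2 hd (disc_of_heegnerCheck (heegnerCheck_of_howardCheck hh)).1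
    (classNumber_of_howardCheck hh).2.1

/-- **SOUNDNESS (`p ∤ h_K`).** For any quadratic number field `K` with `d_K = D` and the record's prime (`q = r.p`):
`¬ q ∣ NumberField.classNumber K` — the binder `not_dvd_classNumber` of `MastellaZerman2026.Hypotheses` (MZ26 Assumption 2.1),
`hh` of `ClassX9.mz26Hypotheses`, `hhK` of the YZ26 composite — IN THE KERNEL. [cite: MastellaZerman2026, Assumption 2.1]
[cite: Cox2013, §7.B Thm. 7.7(ii)] -/
theorem not_dvd_classNumber_of_howardCheck {c : HeegnerCert} (hh : r.howardCheck c = true)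
    (hK2 : Module.finrank ℚ K = 2) (hd : NumberField.discr K = c.D) {q : ℕ} (hq : q = r.p) :
    ¬ q ∣ NumberField.classNumber K := by
  subst hq
  exact not_dvd_classNumber_of_discr_eq hK2 hd (disc_of_heegnerCheck (heegnerCheck_of_howardCheck hh)).1
    (classNumber_of_howardCheck hh).2.1 (classNumber_of_howardCheck hh).2.2

/-- **SOUNDNESS (`d_K` odd)** — the binder `hodd : Odd (NumberField.discr K)` of the YZ26 composite. [folklore] -/
theorem odd_discr_of_howardCheck {c : HeegnerCert} (hh : r.howardCheck c = true) (hd : NumberField.discr K = c.D) :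
    Odd (NumberField.discr K) := by
  rw [hd, Int.odd_iff]
  have h := (classNumber_of_howardCheck hh).1
  omega

/-- **SOUNDNESS (`d_K ≠ -3, -4`)** — the binder `discr_ne` of `MastellaZerman2026.Hypotheses` (`u_K = 1`), from `|d_K| > 4`.
[cite: MastellaZerman2026, Assumption 2.1] [cite: GrossZagier1986, I §3] -/
theorem discr_ne_of_howardCheck {c : HeegnerCert} (hh : r.howardCheck c = true) (hd : NumberField.discr K = c.D) :
    NumberField.discr K ≠ -3 ∧ NumberField.discr K ≠ -4 := by
  have h4 := (disc_of_heegnerCheck (heegnerCheck_of_howardCheck hh)).2.1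
  rw [hd]
  constructor <;> intro h <;> rw [h] at h4 <;> simp at h4

/-- **SOUNDNESS (`p ∤ d_K`)** — the binder `not_dvd_discr` of `MastellaZerman2026.Hypotheses` / `hdK` of the BDP-side theorems,
directly from the certificate's `p ∤ D` (also derivable from `p` split). [cite: MastellaZerman2026, Assumption 2.1] -/
theorem not_dvd_discr_of_howardCheck {c : HeegnerCert} (hh : r.howardCheck c = true) (hd : NumberField.discr K = c.D)
    {q : ℕ} (hq : q = r.p) : ¬ (q : ℤ) ∣ NumberField.discr K := by
  subst hq
  rw [hd]
  intro hdvd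
  exact (split_of_heegnerCheck (heegnerCheck_of_howardCheck hh)).2.1 (Int.emod_eq_zero_of_dvd hdvd)

variable {W : WeierstrassCurve ℚ} [W.IsElliptic] [W.IsGloballyMinimal] (hI : integralModelInt W = r.intCurve)
include hI

/-- **THE HOWARD FRAME, packaged**: for any imaginary quadratic `K` with `d_K = D` and any globally minimal `W` with the
record's integral model, the certificate's `K` satisfies — IN THE KERNEL — every frame binder of records v3 (Heegner hypothesis
for `N(W)` and for `p`, `|d_K| > 4`, `4N ∣ β² − d_K` with the record's conductor, `d_K ≡ 1 (mod 8)` at `p = 3`) AND `Odd d_K`,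
`d_K ≠ -3, -4`, `¬ p ∣ h_K`: all `K`-side hypotheses of `ClassX9.mz26Hypotheses` (`hHeeg`, `hHp`, `hne`, `hh`) and of the
YZ26 composite (`hHN`, `hHp`, `hodd`, `h3`, `hhK`) of the cell's J-free Howard road. [cite: MastellaZerman2026, Assumption 2.1, Cor. 4.6]
[cite: GrossLMS1991, §1 (p. 235)] [cite: Cox2013, §7.B Thm. 7.7(ii)] -/
theorem howardFrame_of_howardCheck (hc : r.check = true) {c : HeegnerCert} (hh : r.howardCheck c = true)
    (hK : IsImaginaryQuadratic K) (hd : NumberField.discr K = c.D) {q : ℕ} (hq : q = r.p) :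
    (SatisfiesHeegnerHypothesis (W.conductorNorm ℤ) K ∧ SatisfiesHeegnerHypothesis q K ∧
      4 < (NumberField.discr K).natAbs ∧ (4 * (r.conductor : ℤ)) ∣ (c.beta : ℤ) ^ 2 - NumberField.discr K ∧
      (q = 3 → NumberField.discr K % 8 = 1)) ∧
    Odd (NumberField.discr K) ∧ (NumberField.discr K ≠ -3 ∧ NumberField.discr K ≠ -4) ∧
      ¬ q ∣ NumberField.classNumber K :=
  ⟨frame_of_heegnerCheck hI hc (heegnerCheck_of_howardCheck hh) hK hd hq, odd_discr_of_howardCheck hh hd,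
    discr_ne_of_howardCheck hh hd, not_dvd_classNumber_of_howardCheck hh hK.1 hd hq⟩

end Frame

end Record

/-! ### Lookup over a display list of certificates -/

/-- Every record of `rs` selected by `sel` has a certificate in `cs` passing `Record.howardCheck` (one Boolean, evaluated by
`decide +kernel` in `X9/PrintCertHowardCertified*.lean`; the kernel recomputes `h(D)` for every certificate it visits). [folklore] -/
def howardScreen (rs : List Record) (sel : Record → Bool) (cs : List HeegnerCert) : Bool :=
  rs.all fun r => !(sel r) || cs.any fun c => r.howardCheck c

/-- Unpacking a passing screen: a selected record has a passing Howard frame certificate in the list. [folklore] -/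
theorem exists_howardCheck_of_howardScreen {rs : List Record} {sel : Record → Bool} {cs : List HeegnerCert}
    (h : howardScreen rs sel cs = true) {r : Record} (hr : r ∈ rs) (hl : sel r = true) :
    ∃ c ∈ cs, r.howardCheck c = true := by
  simp only [howardScreen, List.all_eq_true, Bool.or_eq_true, Bool.not_eq_true', List.any_eq_true] at h
  rcases h r hr with h | h
  · rw [hl] at h; exact absurd h (by decide)
  · exact h

/-- The records-v3 certificates of a display list that already ARE Howard frames: `D` odd and `p ∤ h(D)` (the class-number
value itself is rechecked by `Record.howardCheck`, not trusted from the field). [folklore] -/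
def howardFilter (cs : List HeegnerCert) : List HeegnerCert :=
  cs.filter fun c => decide (c.D % 2 ≠ 0) && decide (¬ c.p ∣ c.classNumber)

/-- Members of `howardFilter cs` are members of `cs`. [folklore] -/
theorem mem_of_mem_howardFilter {cs : List HeegnerCert} {c : HeegnerCert} (h : c ∈ howardFilter cs) : c ∈ cs :=
  (List.mem_filter.1 h).1

/-! ### Kernel self-test on a synthetic certificate: the class-number part alone (`h(−31) = 3`, `5 ∤ 3`; `h(−119) = 10`, `5 ∣ 10`) -/

example : Quadratic.BinQF.classNumber (-31) = 3 ∧ ¬ 5 ∣ 3 := by decide +kernel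

example : Quadratic.BinQF.classNumber (-119) = 10 ∧ 5 ∣ 10 := by decide +kernel

end Summit.BirchSwinnertonDyer.Rank1Residual.X9.PrintCert
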